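import Mathlib
import HarnessLib
import Literature.Combinatorics.Additive.StepBeyondKempermanCheckpointFourPairs
import Literature.Combinatorics.Additive.StepBeyondKempermanFourPairs
import Literature.Combinatorics.Additive.StepBeyondKempermanQuotientKST
import Literature.Combinatorics.Additive.KempermanTypeThreePeriodic
import Literature.Combinatorics.Additive.KempermanTypeTwoFourPairs
import Literature.Combinatorics.Additive.KempermanTypeFourFourPairs
import Literature.Combinatorics.Additive.KempermanTypeOneFourPairs
import Literature.Combinatorics.Additive.StepBeyondKempermanTypeEight

/-!
# Grynkiewicz 2009, §6 Claim 5 complete: Theorem 4.1 for finite `G` reduces to the deep core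

[cite: Grynkiewicz2009, §6 Claim 5 (proof of Thm 4.1, pp. 24–26)] [tag: critical-pair] [tag: inverse-theorem]

Topic `Literature/Combinatorics/Additive`.  Cell `mm-stpp` (D-0046), seat `mm-stpp-lit` (gen 24); the
port of D. J. Grynkiewicz, *A step beyond Kemperman's structure theorem*, Mathematika **55** (2009)
67–114 continued.  This file ASSEMBLES §6 Claim 5 («`d⊆(A + B, 𝒫) ≥ 3`») — i.e. discharges the
hypothesis `fourPairs` of `conclusion_of_fourPairs_of_deepCore` (`StepBeyondKempermanCheckpointFourPairs.lean`),
the last printed case `l = 4` of Claim 5 (print pp. 25 bottom – 26):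

«Let `A + B = C`. … `K = H × H′ ≅ ℤ/2ℤ × ℤ/2ℤ` … `φ_K(γ₁) = φ_K(a₁) + φ_K(b₁)` must be a unique expression
element in `φ_K(A) + φ_K(B)`.  In view of the maximality of `H`, it follows that `φ_H(A + B)` is
aperiodic.  Hence, in view of (40), it follows that we can apply KST to the pair `(φ_H(A), φ_H(B))`. …
(42) … Since `φ_H(A + B)` is aperiodic, it follows that we cannot have type (III).  Suppose we have type
(II). … So type (II) cannot occur.  Suppose we have type (I) … Thus the theorem holds with type (VIII).
Finally, suppose we have type (IV). … contradicting that there are no unique expression elements in a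
type (IV) pair, and completing the case when `d⊆(A + B, P) ≤ 2`.»

Every ingredient is in the tree: the frame (`seventeen_or_fourPairs`), the Klein group and (42)
(`fourPairs_sums_eq`, `fourPairs_display42`, `fourPairs_uniqueExpression_modK`,
`mem_sup_zmultiples_iff`), KST for `(φ_H(A), φ_H(B))` (`exists_isKempermanDecompI_image_mk`), the four
types (`isPeriodic_add_of_isElementaryIII`, `not_isElementaryII_of_twoReps`,
`not_isElementaryIV_of_twoReps`, `structure_of_isElementaryI_of_twoReps`) and the type (VIII)
construction (`exists_isGrynkiewiczDecomp_typeVIII`).  Here: the translation of the frame into the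
(42)-data in `G ⧸ H` (`frame_twoReps`), the translation of the type (I) structure back into the
`K`-section data of `A` and `B` in `G` (`frame_side`), the case `l = 4` (`fourPairs_conclusion`), and the
resulting CHECKPOINT `conclusion_of_deepCore`: **Theorem 4.1 (first part) for finite `G` follows from
the deep core alone** (Claims 9–10 and Subcases 1–4, print pp. 28–34 — not yet in the tree).

MAIN RESULTS (0 definitions, 0 named facts; everything PROVED).
* `Grynkiewicz2009.frame_twoReps`, `Grynkiewicz2009.frame_side`.
* `Grynkiewicz2009.fourPairs_conclusion` — Claim 5, case `l = 4`, in the shape of the hypothesis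
  `fourPairs` of `conclusion_of_fourPairs_of_deepCore`.
* **`Grynkiewicz2009.conclusion_of_deepCore`** — Theorem 4.1 (first part) for finite `G`, modulo the
  deep core (the hypothesis `deep`, unchanged from `conclusion_of_claim5_of_deepCore`).

## References
* D. J. Grynkiewicz, *A step beyond Kemperman's structure theorem*, Mathematika 55 (2009) 67–114,
  doi:10.1112/S0025579300000966, §6 Claim 5 (pp. 24–26) [cite: Grynkiewicz2009, Thm 4.1 (proof,
  Claim 5)] — held `paper:doi-10-1112-s0025579300000966`, p0025–p0026 read 2026-08-29.
-/

namespace Literature.Combinatorics.Additive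

open Finset
open scoped Pointwise

universe u

variable {G : Type u} [AddCommGroup G] [DecidableEq G]

namespace Grynkiewicz2009

/-! ### The frame in `G ⧸ H`: the (42)-data -/

omit [DecidableEq G] in
/-- **Display (42) in `G ⧸ H`.**  In the `l = 4` frame (with `d = x′ − x = y′ − y`), for
`ū ∈ φ_H(A)`, `v̄ ∈ φ_H(B)` with `ū + v̄ ∈ {φ_H(x + y), φ_H(x + y) + φ_H(d)}` one has
`ū ∈ {φ_H(x), φ_H(x) + φ_H(d)}` and `v̄ ∈ {φ_H(y), φ_H(y) + φ_H(d)}` («both elements in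
`φ_H({a₁, a₂} + {b₁, b₂})` have exactly two representations in `φ_H(A) + φ_H(B)` given by (42)»).
[cite: Grynkiewicz2009, §6 Claim 5, display (42)] -/
theorem frame_twoReps [DecidableEq G] {A B : Finset G} {H : AddSubgroup G} [DecidableEq (G ⧸ H)]
    {γ₁ γ₂ x y x' y' : G} (hxx' : x - x' ∉ H) (hyy' : y - y' ∉ H)
    (hxy : x + y - γ₁ ∈ H ∨ x + y - γ₂ ∈ H) (hxy' : x + y' - γ₁ ∈ H ∨ x + y' - γ₂ ∈ H)
    (hrelA : ∀ u ∈ A, ∀ v ∈ B, (u + v - γ₁ ∈ H ∨ u + v - γ₂ ∈ H) → u - x ∈ H ∨ u - x' ∈ H)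
    (hrelB : ∀ u ∈ A, ∀ v ∈ B, (u + v - γ₁ ∈ H ∨ u + v - γ₂ ∈ H) → v - y ∈ H ∨ v - y' ∈ H)
    {d : G} (hx'd : x' = x + d) (hy'd : y' = y + d) :
    ∀ uq ∈ A.image (QuotientAddGroup.mk : G → G ⧸ H), ∀ vq ∈ B.image (QuotientAddGroup.mk : G → G ⧸ H),
      (uq + vq = QuotientAddGroup.mk x + QuotientAddGroup.mk y ∨
        uq + vq = QuotientAddGroup.mk x + QuotientAddGroup.mk y + QuotientAddGroup.mk d) →
      (uq = QuotientAddGroup.mk x ∨ uq = QuotientAddGroup.mk x + QuotientAddGroup.mk d) ∧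
        (vq = QuotientAddGroup.mk y ∨ vq = QuotientAddGroup.mk y + QuotientAddGroup.mk d) := by
  intro uq huq vq hvq h
  obtain ⟨u, hu, rfl⟩ := mem_image.1 huq
  obtain ⟨v, hv, rfl⟩ := mem_image.1 hvq
  have h42 := fourPairs_display42 (A := A) (B := B) hxx' hyy' hxy hxy' hrelA hrelB hu hv
  have ex : ∀ {p q : G}, (QuotientAddGroup.mk p : G ⧸ H) = QuotientAddGroup.mk q ↔ p - q ∈ H :=
    fun {p q} => QuotientAddGroup.eq_iff_sub_mem
  have e1 : ((QuotientAddGroup.mk u : G ⧸ H) + QuotientAddGroup.mk v =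
      QuotientAddGroup.mk x + QuotientAddGroup.mk y) ↔ u + v - (x + y) ∈ H := by
    rw [← QuotientAddGroup.mk_add, ← QuotientAddGroup.mk_add, ex]
  have e2 : ((QuotientAddGroup.mk u : G ⧸ H) + QuotientAddGroup.mk v =
      QuotientAddGroup.mk x + QuotientAddGroup.mk y + QuotientAddGroup.mk d) ↔
      u + v - (x + y') ∈ H := by
    rw [← QuotientAddGroup.mk_add, ← QuotientAddGroup.mk_add, ← QuotientAddGroup.mk_add, ex, hy'd,
      add_assoc]
  have cx : (QuotientAddGroup.mk u : G ⧸ H) = QuotientAddGroup.mk x + QuotientAddGroup.mk d ↔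
      u - x' ∈ H := by
    rw [← QuotientAddGroup.mk_add, ← hx'd, ex]
  have cy : (QuotientAddGroup.mk v : G ⧸ H) = QuotientAddGroup.mk y + QuotientAddGroup.mk d ↔
      v - y' ∈ H := by
    rw [← QuotientAddGroup.mk_add, ← hy'd, ex]
  rw [e1, e2] at h
  rw [cx, cy, ex, ex]
  rcases h with h | h
  · rcases h42.1 h with ⟨h1, h2⟩ | ⟨h1, h2⟩
    · exact ⟨Or.inl h1, Or.inl h2⟩
    · exact ⟨Or.inr h1, Or.inr h2⟩
  · rcases h42.2 h with ⟨h1, h2⟩ | ⟨h1, h2⟩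
    · exact ⟨Or.inl h1, Or.inr h2⟩
    · exact ⟨Or.inr h1, Or.inl h2⟩

/-! ### From the type (I) structure in `G ⧸ H` to the `K`-sections in `G` -/

/-- **The `K`-sections of `A` in the type (I) case.**  In the `l = 4` frame (`A ∩ (x + H) = {x}`,
`A ∩ (x′ + H) = {x′}`, no other `H`-holes, `x′ = x + d`, `2d = 0`, `d ∉ H`), if `φ_H(A) = A₁ ∪ {ā₀}` is a
quasi-periodic decomposition with quasi-period `L ∋ φ_H(d)` and `φ_H(x), φ_H(x′) ∈ A₁`, then for the
Klein group `K = H ∪ (d + H)` and a lift `a₀ ∈ A` of `ā₀`: `A ∩ (x + K) = {x, x + d}`,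
`A ∩ (a₀ + K) = a₀ + H`, every other `K`-coset of `A` is full, and `x ≢ a₀ (mod K)`.
[cite: Grynkiewicz2009, §6 Claim 5 (p. 26, type (I) ⟹ type (VIII))] -/
theorem frame_side {H K : AddSubgroup G} {Hf Kf A : Finset G} {x x' d a₀ : G} [DecidableEq (G ⧸ H)]
    (hHf : ∀ g, g ∈ Hf ↔ g ∈ H) (hKmem : ∀ g, g ∈ K ↔ g ∈ H ∨ g - d ∈ H)
    (hKf : Kf = Hf ∪ (d +ᵥ Hf)) (hd : x' = x + d) (h2d : d + d = 0) (hdH : d ∉ H)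
    (hAxH : A ∩ (x +ᵥ Hf) = {x}) (hAx'H : A ∩ (x' +ᵥ Hf) = {x'})
    (hholes : (A + Hf) \ ((x +ᵥ Hf) ∪ (x' +ᵥ Hf)) ⊆ A)
    {L : AddSubgroup (G ⧸ H)} {A₁ : Finset (G ⧸ H)} {aq : G ⧸ H}
    (hdec : IsQuasiPeriodicDecomp L (A.image (QuotientAddGroup.mk : G → G ⧸ H)) A₁ {aq})
    (hdL : (QuotientAddGroup.mk d : G ⧸ H) ∈ L)
    (hx₁ : (QuotientAddGroup.mk x : G ⧸ H) ∈ A₁) (hx'₁ : (QuotientAddGroup.mk x' : G ⧸ H) ∈ A₁)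
    (ha₀ : a₀ ∈ A) (haq : (QuotientAddGroup.mk a₀ : G ⧸ H) = aq) :
    A ∩ (x +ᵥ Kf) = {x, x + d} ∧ A ∩ (a₀ +ᵥ Kf) = a₀ +ᵥ Hf ∧
      (∀ u ∈ A, u - x ∉ K → u - a₀ ∉ K → u +ᵥ Kf ⊆ A) ∧ x - a₀ ∉ K := by
  have ex : ∀ {p q : G}, (QuotientAddGroup.mk p : G ⧸ H) = QuotientAddGroup.mk q ↔ p - q ∈ H :=
    fun {p q} => QuotientAddGroup.eq_iff_sub_mem
  have hsplit : ∀ c : G, c +ᵥ Kf = (c +ᵥ Hf) ∪ ((c + d) +ᵥ Hf) := fun c => by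
    rw [hKf, vadd_finset_union, vadd_vadd]
  have hx : x ∈ A := by
    have : x ∈ A ∩ (x +ᵥ Hf) := by rw [hAxH]; exact mem_singleton_self _
    exact (mem_inter.1 this).1
  -- `aq` is neither `φ(x)` nor `φ(x')`
  have haqmem : aq ∈ ({aq} : Finset (G ⧸ H)) := mem_singleton_self _
  have hxa₀ : x - a₀ ∉ H := fun h =>
    disjoint_left.1 hdec.disjoint hx₁ (by rw [ex.2 h, haq]; exact haqmem)
  have hx'a₀ : x' - a₀ ∉ H := fun h =>
    disjoint_left.1 hdec.disjoint hx'₁ (by rw [ex.2 h, haq]; exact haqmem)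
  have hperAH : IsPeriodicWith H (A + Hf) := isPeriodicWith_add_of_forall_mem_iff hHf A
  -- the complement of the two special `H`-cosets inside a coset `c + H`, `c ≢ x, x'`
  have away : ∀ {c z : G}, z - c ∈ H → c - x ∉ H → c - x' ∉ H →
      z ∉ (x +ᵥ Hf) ∪ (x' +ᵥ Hf) := by
    intro c z hz hcx hcx'
    rw [mem_union, mem_vadd_carrier_iff hHf, mem_vadd_carrier_iff hHf, not_or]
    constructor
    · intro h; apply hcx
      have := H.sub_mem h hz; rwa [sub_sub_sub_cancel_left] at this
    · intro h; apply hcx'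
      have := H.sub_mem h hz; rwa [sub_sub_sub_cancel_left] at this
  refine ⟨?_, ?_, ?_, ?_⟩
  · rw [hsplit, inter_union_distrib_left, hAxH, ← hd, hAx'H, singleton_union, hd]
  · rw [hsplit, inter_union_distrib_left]
    have h1 : A ∩ (a₀ +ᵥ Hf) = a₀ +ᵥ Hf := by
      refine inter_eq_right.2 fun z hz => hholes (mem_sdiff.2 ⟨?_, ?_⟩)
      · obtain ⟨h, hh, rfl⟩ := mem_vadd_finset.1 hz
        exact mem_add.2 ⟨a₀, ha₀, h, hh, rfl⟩
      · refine away ((mem_vadd_carrier_iff hHf).1 hz) (fun h => hxa₀ ?_) (fun h => hx'a₀ ?_)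
        · have := H.neg_mem h; rwa [neg_sub] at this
        · have := H.neg_mem h; rwa [neg_sub] at this
    have h2 : A ∩ ((a₀ + d) +ᵥ Hf) = ∅ := by
      refine eq_empty_iff_forall_notMem.2 fun z hz => ?_
      obtain ⟨hzA, hz⟩ := mem_inter.1 hz
      rw [mem_vadd_carrier_iff hHf] at hz
      have hmk : (QuotientAddGroup.mk z : G ⧸ H) = aq + QuotientAddGroup.mk d := by
        rw [← haq, ← QuotientAddGroup.mk_add]; exact ex.2 hz
      have hzim : (QuotientAddGroup.mk z : G ⧸ H) ∈ A₁ ∪ {aq} := by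
        rw [hdec.union_eq]; exact mem_image_of_mem _ hzA
      rcases mem_union.1 hzim with hz₁ | hz₀
      · have : -(QuotientAddGroup.mk d : G ⧸ H) + (aq + QuotientAddGroup.mk d) ∈ A₁ := by
          rw [← hmk]; exact hdec.periodic.add_mem (L.neg_mem hdL) hz₁
        rw [show -(QuotientAddGroup.mk d : G ⧸ H) + (aq + QuotientAddGroup.mk d) = aq by abel] at this
        exact disjoint_left.1 hdec.disjoint this haqmem
      · rw [mem_singleton, hmk, add_eq_left, QuotientAddGroup.eq_zero_iff] at hz₀
        exact hdH hz₀
    rw [h1, h2, union_empty]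
  · intro u hu hux hua z hz
    -- `φ(u)` lies in the periodic part, so `u + d ∈ A + H`
    have huim : (QuotientAddGroup.mk u : G ⧸ H) ∈ A₁ ∪ {aq} := by
      rw [hdec.union_eq]; exact mem_image_of_mem _ hu
    have hu₁ : (QuotientAddGroup.mk u : G ⧸ H) ∈ A₁ := by
      refine (mem_union.1 huim).resolve_right fun h0 => hua ((hKmem _).2 (Or.inl ?_))
      rw [mem_singleton, ← haq, ex] at h0; exact h0
    have hud : u + d ∈ A + Hf := by
      rw [mem_add_carrier_iff_image_mk hHf, QuotientAddGroup.mk_add]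
      have := hdec.periodic.add_mem hdL hu₁
      rw [add_comm] at this
      exact hdec.left_subset this
    have hux' : u - x ∉ H := fun h => hux ((hKmem _).2 (Or.inl h))
    have huxd : u - x - d ∉ H := fun h => hux ((hKmem _).2 (Or.inr h))
    rw [hsplit, mem_union] at hz
    rcases hz with hz | hz
    · refine hholes (mem_sdiff.2 ⟨?_, ?_⟩)
      · obtain ⟨h, hh, rfl⟩ := mem_vadd_finset.1 hz
        exact mem_add.2 ⟨u, hu, h, hh, rfl⟩
      · refine away ((mem_vadd_carrier_iff hHf).1 hz) hux' fun h => huxd ?_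
        rwa [hd, ← sub_sub] at h
    · refine hholes (mem_sdiff.2 ⟨?_, ?_⟩)
      · obtain ⟨h, hh, rfl⟩ := mem_vadd_finset.1 hz
        rw [vadd_eq_add, add_comm (u + d)]
        exact hperAH.add_mem ((hHf h).1 hh) hud
      · refine away ((mem_vadd_carrier_iff hHf).1 hz) (fun h => huxd ?_) (fun h => hux' ?_)
        · have e : u - x - d = u + d - x - (d + d) := by abel
          rw [e, h2d, sub_zero]; exact h
        · rwa [hd, show u + d - (x + d) = u - x by abel] at h
  · intro h
    rcases (hKmem _).1 h with h | h
    · exact hxa₀ h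
    · apply hx'a₀
      rw [hd, show x + d - a₀ = x - a₀ - d + (d + d) by abel, h2d, add_zero]; exact h

/-! ### Claim 5, case `l = 4` -/

/-- **§6 Claim 5, case `l = 4`** (print pp. 25–26), in the shape of the hypothesis `fourPairs` of
`conclusion_of_fourPairs_of_deepCore`: in the frame delivered by `seventeen_or_fourPairs` the
conclusion of Theorem 4.1 holds (with type (VIII)).  KST is applied to `(φ_H(A), φ_H(B))`
(`exists_isKempermanDecompI_image_mk`); types (III), (II), (IV) cannot occur
(`isPeriodic_add_of_isElementaryIII`, `not_isElementaryII_of_twoReps`,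
`not_isElementaryIV_of_twoReps`); type (I) forces `L = K/H`, `|A₀′| = |B₀′| = 1`
(`structure_of_isElementaryI_of_twoReps`), whence the `K`-section data (`frame_side`) and «the
theorem holds with type (VIII)» (`exists_isGrynkiewiczDecomp_typeVIII`).
[cite: Grynkiewicz2009, §6 Claim 5 (pp. 25–26, case l = 4)] -/
theorem fourPairs_conclusion [Fintype G] {A B : Finset G} (h0A : (0 : G) ∈ A) (h0B : (0 : G) ∈ B)
    (hA3 : 3 ≤ #A) (H : AddSubgroup G) (Hf : Finset G) (γ₁ γ₂ x y x' y' : G)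
    (hframe : (∀ g, g ∈ Hf ↔ g ∈ H) ∧ #Hf = 2 ∧ (insert γ₁ (insert γ₂ (A + B))).addStab = Hf ∧
        γ₁ ∉ A + B ∧ γ₂ ∉ A + B ∧ γ₁ ≠ γ₂ ∧ γ₁ - γ₂ ∉ H ∧
        insert γ₁ (insert γ₂ (A + B)) = A + B + Hf ∧
        #(A + Hf) + #(B + Hf) = #A + #B + #Hf + 2 ∧
        cosetCount H (A + B) + 1 = cosetCount H A + cosetCount H B ∧
        x ∈ A ∧ y ∈ B ∧ x' ∈ A ∧ y' ∈ B ∧ x - x' ∉ H ∧ y - y' ∉ H ∧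
        (x + y - γ₁ ∈ H ∨ x + y - γ₂ ∈ H) ∧ (x' + y' - γ₁ ∈ H ∨ x' + y' - γ₂ ∈ H) ∧
        (x + y' - γ₁ ∈ H ∨ x + y' - γ₂ ∈ H) ∧ (x' + y - γ₁ ∈ H ∨ x' + y - γ₂ ∈ H) ∧
        (∀ u ∈ A, ∀ v ∈ B, (u + v - γ₁ ∈ H ∨ u + v - γ₂ ∈ H) → u - x ∈ H ∨ u - x' ∈ H) ∧
        (∀ u ∈ A, ∀ v ∈ B, (u + v - γ₁ ∈ H ∨ u + v - γ₂ ∈ H) → v - y ∈ H ∨ v - y' ∈ H) ∧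
        #(A ∩ (x +ᵥ Hf)) + #(B ∩ (y +ᵥ Hf)) = 2 ∧ #(A ∩ (x' +ᵥ Hf)) + #(B ∩ (y' +ᵥ Hf)) = 2 ∧
        (A + Hf) \ ((x +ᵥ Hf) ∪ (x' +ᵥ Hf)) ⊆ A ∧ (B + Hf) \ ((y +ᵥ Hf) ∪ (y' +ᵥ Hf)) ⊆ B) :
    (∃ α β : G, #(insert α A + insert β B) + 1 = #(insert α A) + #(insert β B)) ∨
      ∃ (N : AddSubgroup G) (A₁ A₀ B₁ B₀ : Finset G), IsGrynkiewiczDecomp N A B A₁ A₀ B₁ B₀ := by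
  obtain ⟨hHf, hHf2, hstabP, hγ₁, hγ₂, -, hγ₁₂, hPeq, -, h40, hx, hy, hx', hy', hxx', hyy', hxy, hx'y',
    hxy', hx'y, hrelA, hrelB, hone, hone', hholesA, hholesB⟩ := hframe
  haveI : DecidableEq (G ⧸ H) := Classical.decEq _
  have hA : A.Nonempty := ⟨0, h0A⟩
  have hB : B.Nonempty := ⟨0, h0B⟩
  have ex : ∀ {p q : G}, (QuotientAddGroup.mk p : G ⧸ H) = QuotientAddGroup.mk q ↔ p - q ∈ H :=
    fun {p q} => QuotientAddGroup.eq_iff_sub_mem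
  -- the Klein group data: `d = x' - x = y' - y`, `2d = 0`, `d ∉ H`
  obtain ⟨-, -, e3, h2d, hdH⟩ :=
    fourPairs_sums_eq hHf hHf2 hγ₁ hγ₂ hγ₁₂ hx hy hx' hy' hxx' hyy' hxy hx'y' hxy' hx'y
  set d := x' - x with hddef
  have hx'd : x' = x + d := by rw [hddef]; abel
  have hy'd : y' = y + d := by rw [e3]; abel
  -- `H ≠ ⊤` and the maximality of `H`
  have hstab : (A + B + Hf).addStab = Hf := by rw [← hPeq]; exact hstabP
  have hHtop : H ≠ ⊤ := by
    intro hT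
    have hsub : A ⊆ Hf := fun a _ => (hHf a).2 (by rw [hT]; exact AddSubgroup.mem_top a)
    have := card_le_card hsub
    omega
  -- KST for `(φ_H(A), φ_H(B))`
  obtain ⟨L, A₁, A₀, B₁, B₀, hq⟩ := exists_isKempermanDecompI_image_mk hHf hHtop hstab hA hB h40
  have hap : ¬ IsPeriodic (A.image (QuotientAddGroup.mk : G → G ⧸ H) +
      B.image (QuotientAddGroup.mk : G → G ⧸ H)) := by
    rw [← image_mk_add']
    exact not_isPeriodic_image_mk_of_addStab_eq hHf hstab (hA.add hB)
  -- the (42)-data in `G ⧸ H`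
  have hK := frame_twoReps (A := A) (B := B) hxx' hyy' hxy hxy' hrelA hrelB hx'd hy'd
  have hmx : (QuotientAddGroup.mk x : G ⧸ H) ∈ A.image (QuotientAddGroup.mk : G → G ⧸ H) :=
    mem_image_of_mem _ hx
  have hmy : (QuotientAddGroup.mk y : G ⧸ H) ∈ B.image (QuotientAddGroup.mk : G → G ⧸ H) :=
    mem_image_of_mem _ hy
  have hmxd : (QuotientAddGroup.mk x : G ⧸ H) + QuotientAddGroup.mk d ∈
      A.image (QuotientAddGroup.mk : G → G ⧸ H) := by
    rw [← QuotientAddGroup.mk_add, ← hx'd]; exact mem_image_of_mem _ hx'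
  have hmyd : (QuotientAddGroup.mk y : G ⧸ H) + QuotientAddGroup.mk d ∈
      B.image (QuotientAddGroup.mk : G → G ⧸ H) := by
    rw [← QuotientAddGroup.mk_add, ← hy'd]; exact mem_image_of_mem _ hy'
  have hdq0 : (QuotientAddGroup.mk d : G ⧸ H) ≠ 0 := fun h =>
    hdH ((QuotientAddGroup.eq_zero_iff d).1 h)
  have h2dq : (QuotientAddGroup.mk d : G ⧸ H) + QuotientAddGroup.mk d = 0 := by
    rw [← QuotientAddGroup.mk_add, h2d, QuotientAddGroup.mk_zero]
  -- (42) for the single target `φ(x) + φ(y)`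
  have h42 : ∀ uq ∈ A.image (QuotientAddGroup.mk : G → G ⧸ H),
      ∀ vq ∈ B.image (QuotientAddGroup.mk : G → G ⧸ H),
      uq + vq = QuotientAddGroup.mk x + QuotientAddGroup.mk y →
      (uq = QuotientAddGroup.mk x ∧ vq = QuotientAddGroup.mk y) ∨
        (uq = QuotientAddGroup.mk x + QuotientAddGroup.mk d ∧
          vq = QuotientAddGroup.mk y + QuotientAddGroup.mk d) := by
    intro uq huq vq hvq huv
    obtain ⟨hu, -⟩ := hK uq huq vq hvq (Or.inl huv)
    rcases hu with rfl | rfl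
    · exact Or.inl ⟨rfl, add_left_cancel huv⟩
    · have h1 : (QuotientAddGroup.mk d : G ⧸ H) + vq = QuotientAddGroup.mk y :=
        add_left_cancel ((add_assoc _ _ _).symm.trans huv)
      refine Or.inr ⟨rfl, ?_⟩
      calc vq = QuotientAddGroup.mk d + vq + QuotientAddGroup.mk d := by
            rw [add_comm (QuotientAddGroup.mk d) vq, add_assoc, h2dq, add_zero]
        _ = QuotientAddGroup.mk y + QuotientAddGroup.mk d := by rw [h1]
  -- the type (I) branch: «Thus the theorem holds with type (VIII)»
  have typeI : IsElementaryI A₀ B₀ →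
      ((∃ α β : G, #(insert α A + insert β B) + 1 = #(insert α A) + #(insert β B)) ∨
        ∃ (N : AddSubgroup G) (A₁ A₀ B₁ B₀ : Finset G), IsGrynkiewiczDecomp N A B A₁ A₀ B₁ B₀) := by
    intro hI
    obtain ⟨aq, bq, hA₀, hB₀, hL, hx₁, hxd₁, hy₁, hyd₁⟩ :=
      hq.structure_of_isElementaryI_of_twoReps hap hmx hmxd hmy hmyd hdq0 h2dq hK hI
    -- lifts of the bottom elements
    obtain ⟨a₀, ha₀, haq⟩ := mem_image.1
      (hq.decomp_left.right_subset (by rw [hA₀]; exact mem_singleton_self _) : aq ∈ _)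
    obtain ⟨b₀, hb₀, hbq⟩ := mem_image.1
      (hq.decomp_right.right_subset (by rw [hB₀]; exact mem_singleton_self _) : bq ∈ _)
    -- the Klein group `K = H ⊔ ⟨d⟩ = H ∪ (d + H)`
    set K : AddSubgroup G := H ⊔ AddSubgroup.zmultiples d with hKdef
    have hKmem : ∀ g, g ∈ K ↔ g ∈ H ∨ g - d ∈ H := mem_sup_zmultiples_iff h2d
    set Kf : Finset G := Hf ∪ (d +ᵥ Hf) with hKfdef
    have hKf : ∀ g, g ∈ Kf ↔ g ∈ K := fun g => by
      rw [hKfdef, mem_union, mem_vadd_carrier_iff hHf, hHf, hKmem]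
    have hHK : H ≤ K := le_sup_left
    have hdK : d ∈ K := (hKmem d).2 (Or.inr (by rw [sub_self]; exact H.zero_mem))
    have hKf4 : #Kf = 4 := by
      have hdisj : Disjoint Hf (d +ᵥ Hf) := by
        rw [disjoint_left]
        rintro z hz hz'
        rw [mem_vadd_carrier_iff hHf] at hz'
        exact hdH (by have := H.sub_mem ((hHf z).1 hz) hz'; rwa [sub_sub_cancel] at this)
      rw [hKfdef, card_union_of_disjoint hdisj, card_vadd_finset, hHf2]
    have hK2 : ∀ k ∈ K, k + k = 0 := by
      obtain ⟨h₀, hh₀0, hh₀H, hHmem⟩ := exists_generator_of_card_eq_two hHf hHf2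
      have hh₀2 : h₀ + h₀ = 0 := by
        rcases (hHmem _).1 (H.add_mem hh₀H hh₀H) with h | h
        · exact h
        · exact absurd (add_eq_left.1 h) hh₀0
      have hH2 : ∀ h ∈ H, h + h = 0 := fun h hh => by
        rcases (hHmem h).1 hh with rfl | rfl
        · exact add_zero 0
        · exact hh₀2
      intro k hk
      rcases (hKmem k).1 hk with h | h
      · exact hH2 k h
      · calc k + k = (k - d) + (k - d) + (d + d) := by abel
          _ = 0 := by rw [hH2 _ h, h2d, add_zero]
    have memKL : ∀ g, g ∈ K ↔ (QuotientAddGroup.mk g : G ⧸ H) ∈ L := fun g => by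
      rw [hKmem, hL, QuotientAddGroup.eq_zero_iff, ex]
    have hKcomap : K = L.comap (QuotientAddGroup.mk' H) := by
      ext g; rw [AddSubgroup.mem_comap, QuotientAddGroup.mk'_apply]; exact memKL g
    -- the `H`-sections at `x, x', y, y'` are singletons
    have self_mem : ∀ {S : Finset G} {p : G}, p ∈ S → p ∈ S ∩ (p +ᵥ Hf) := fun {S p} hp =>
      mem_inter.2 ⟨hp, mem_vadd_finset.2 ⟨0, (hHf 0).2 H.zero_mem, by simp⟩⟩
    have secH : ∀ {S T : Finset G} {p q : G}, p ∈ S → q ∈ T →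
        #(S ∩ (p +ᵥ Hf)) + #(T ∩ (q +ᵥ Hf)) = 2 → S ∩ (p +ᵥ Hf) = {p} := by
      intro S T p q hp hq h
      have h1 := card_pos.2 ⟨p, self_mem hp⟩
      have h2 := card_pos.2 ⟨q, self_mem hq⟩
      obtain ⟨z, hz⟩ := card_eq_one.1 (show #(S ∩ (p +ᵥ Hf)) = 1 by omega)
      have hp' := self_mem (S := S) hp
      rw [hz, mem_singleton] at hp'
      rw [hz, hp']
    have hAxH : A ∩ (x +ᵥ Hf) = {x} := secH hx hy hone
    have hByH : B ∩ (y +ᵥ Hf) = {y} := secH hy hx (by rw [add_comm]; exact hone)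
    have hAx'H : A ∩ (x' +ᵥ Hf) = {x'} := secH hx' hy' hone'
    have hBy'H : B ∩ (y' +ᵥ Hf) = {y'} := secH hy' hx' (by rw [add_comm]; exact hone')
    -- the `K`-sections on both sides
    have hdL : (QuotientAddGroup.mk d : G ⧸ H) ∈ L := (hL _).2 (Or.inr rfl)
    have hdecA : IsQuasiPeriodicDecomp L (A.image (QuotientAddGroup.mk : G → G ⧸ H)) A₁ {aq} := by
      rw [← hA₀]; exact hq.decomp_left
    have hdecB : IsQuasiPeriodicDecomp L (B.image (QuotientAddGroup.mk : G → G ⧸ H)) B₁ {bq} := by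
      rw [← hB₀]; exact hq.decomp_right
    have hx'₁ : (QuotientAddGroup.mk x' : G ⧸ H) ∈ A₁ := by
      rw [hx'd, QuotientAddGroup.mk_add]; exact hxd₁
    have hy'₁ : (QuotientAddGroup.mk y' : G ⧸ H) ∈ B₁ := by
      rw [hy'd, QuotientAddGroup.mk_add]; exact hyd₁
    obtain ⟨hAx, hAa, hAfull, hxa⟩ :=
      frame_side hHf hKmem hKfdef hx'd h2d hdH hAxH hAx'H hholesA hdecA hdL hx₁ hx'₁ ha₀ haq
    obtain ⟨hBy, hBb, hBfull, hyb⟩ :=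
      frame_side hHf hKmem hKfdef hy'd h2d hdH hByH hBy'H hholesB hdecB hdL hy₁ hy'₁ hb₀ hbq
    -- (i) modulo `K` for `x + y`: «φ_K(γ₁) = φ_K(a₁) + φ_K(b₁) is a unique expression element»
    have hxyγ : x + y - γ₁ ∈ K := by
      rcases hxy with h | h
      · exact hHK h
      · rcases hx'y with h' | h'
        · refine (hKmem _).2 (Or.inr ?_)
          have e : x + y - γ₁ - d = x' + y - γ₁ - (d + d) := by rw [hx'd]; abel
          rw [e, h2d, sub_zero]; exact h'
        · exfalso
          apply hdH
          have := H.sub_mem h' h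
          rwa [hx'd, show x + d + y - γ₂ - (x + y - γ₂) = d by abel] at this
    have hKxy : ∀ u ∈ A, ∀ v ∈ B, u + v - (x + y) ∈ K → u - x ∈ K ∧ v - y ∈ K := by
      intro u hu v hv huv
      have h' : u + v - γ₁ ∈ K := by
        have := K.add_mem huv hxyγ
        rwa [show u + v - (x + y) + (x + y - γ₁) = u + v - γ₁ by abel] at this
      exact fourPairs_uniqueExpression_modK hHf hHf2 hγ₁ hγ₂ hγ₁₂ hx hy hx' hy' hxx' hyy' hxy hx'y'
        hxy' hx'y hrelA hrelB hu hv h'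
    -- (i) modulo `K` for `a₀ + b₀`: condition (i) of the decomposition, `L = K/H`
    have hKab : ∀ u ∈ A, ∀ v ∈ B, u + v - (a₀ + b₀) ∈ K → u - a₀ ∈ K ∧ v - b₀ ∈ K := by
      intro u hu v hv huv
      have h' := hq.quot_unique _ (mem_image_of_mem _ hu) _ (mem_image_of_mem _ hv) aq
        (by rw [hA₀]; exact mem_singleton_self _) bq (by rw [hB₀]; exact mem_singleton_self _)
        (by
          rw [← haq, ← hbq, ← QuotientAddGroup.mk_add, ← QuotientAddGroup.mk_add,
            ← QuotientAddGroup.mk_sub]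
          exact (memKL _).1 huv)
      rw [← haq, ← hbq, ← QuotientAddGroup.mk_sub, ← QuotientAddGroup.mk_sub, ← memKL, ← memKL] at h'
      exact h'
    -- (ii) modulo `K`
    have hiiK : cosetCount K (A + B) + 1 = cosetCount K A + cosetCount K B := by
      rw [hKcomap, cosetCount_comap_mk, cosetCount_comap_mk, cosetCount_comap_mk, image_mk_add_eq]
      exact hq.cosetCount_add
    obtain ⟨N, X₁, X₀, Y₁, Y₀, hdec, -⟩ :=
      exists_isGrynkiewiczDecomp_typeVIII hKf hHf hKf4 hHf2 hHK hK2 hdK hdH hx hy ha₀ hb₀ hAx hAa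
        hAfull hBy hBb hBfull hxa hyb hKxy hKab hiiK
    exact Or.inr ⟨N, X₁, X₀, Y₁, Y₀, hdec⟩
  -- the four types
  rcases hq.elementary with hI | hII | hIII | hIV
  · exact typeI hI
  · exact absurd hII (hq.not_isElementaryII_of_twoReps hap hmx hmxd hmy hmyd hdq0 h2dq h42)
  · -- type (III): `A + B` would be periodic; the degenerate case `|A₀| = |B₀| = 1` is type (I)
    by_cases h3 : 3 ≤ #A₀ + #B₀
    · exact absurd (hq.isPeriodic_add_of_isElementaryIII hIII h3) hap
    · have h1 := card_pos.2 hq.left_nonempty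
      have h2 := card_pos.2 hq.right_nonempty
      exact typeI ⟨hq.left_nonempty, hq.right_nonempty, Or.inl (by omega)⟩
  · exact absurd hIV (hq.not_isElementaryIV_of_twoReps hmx hmxd hmy hdq0 h2dq hK)

/-! ### The checkpoint: Theorem 4.1 for finite `G` ⇐ the deep core -/

/-- **Theorem 4.1 (first part) for finite `G`, modulo the deep core.**  With §6 Claim 5 complete
(`fourPairs_conclusion`), `conclusion_of_fourPairs_of_deepCore` leaves only the «deep core» of the
main proof (print pp. 28–34: `|A| ≥ 3`, `|B| ≥ 4`, `d⊆(C, QP) ≥ 2` for `C ∈ {A, B, (A+B)ᶜ}`,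
`d⊆(·, P) ≥ 3` for the complements, `d⊆(C, QAP_d) ≥ 2`, (48), (49), not `|A| = |(A+B)ᶜ| = 3` — Claims
9–10 and Subcases 1–4) as the hypothesis `deep`: for finite nonempty `A, B` with
`|A + B| = |A| + |B|` and `A + B` aperiodic, either (17) holds for some `α, β`, or `A`, `B` have
quasi-periodic decompositions with a common quasi-period satisfying (i), (ii) and (iii) of Theorem 4.1
(`IsGrynkiewiczDecomp`). [cite: Grynkiewicz2009, Thm 4.1; §6 (proof, Claims 1–8, 11)] -/
theorem conclusion_of_deepCore [Fintype G]
    (deep : ∀ (G' : AddSubgroup G) [Fintype ↥G'] (A B : Finset ↥G'),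
      (0 : ↥G') ∈ A → (0 : ↥G') ∈ B → 3 ≤ #A → 4 ≤ #B → #(A + B) = #A + #B →
      (A + B).addStab = {0} →
      (∀ P : Finset ↥G', A + B ⊆ P → P.addStab ≠ {0} → 3 ≤ #(P \ (A + B))) →
      IsNonExtendible A B → IsNonExtendible B A → ¬ IsQuasiPeriodic A → ¬ IsQuasiPeriodic B →
      AddSubgroup.closure (A : Set ↥G') = ⊤ → AddSubgroup.closure (B : Set ↥G') = ⊤ →
      2 ≤ subsetDist A {P | IsQuasiPeriodic P} → 2 ≤ subsetDist B {P | IsQuasiPeriodic P} →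
      (∀ P : Finset ↥G', Aᶜ ⊆ P → P.addStab ≠ {0} → 3 ≤ #(P \ Aᶜ)) →
      (∀ P : Finset ↥G', Bᶜ ⊆ P → P.addStab ≠ {0} → 3 ≤ #(P \ Bᶜ)) →
      2 ≤ subsetDist (A + B)ᶜ {P | IsQuasiPeriodic P} →
      (∀ d : ↥G', d ≠ 0 → 2 ≤ subsetDist A {P | IsQuasiProgression d P}) →
      (∀ d : ↥G', d ≠ 0 → 2 ≤ subsetDist B {P | IsQuasiProgression d P}) →
      (∀ d : ↥G', d ≠ 0 → 2 ≤ subsetDist (A + B)ᶜ {P | IsQuasiProgression d P}) →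
      (∀ b ∈ B, #(layerWith A B 1 {b}) ≤ 1) → (∀ a ∈ A, #(layerWith B A 1 {a}) ≤ 1) →
      ¬ (#A = 3 ∧ #(A + B)ᶜ = 3) →
      ((∃ α β : ↥G', #(insert α A + insert β B) + 1 = #(insert α A) + #(insert β B)) ∨
        ∃ (K : AddSubgroup ↥G') (A₁ A₀ B₁ B₀ : Finset ↥G'), IsGrynkiewiczDecomp K A B A₁ A₀ B₁ B₀))
    {A B : Finset G} (hA : A.Nonempty) (hB : B.Nonempty) (hAB : #(A + B) = #A + #B)
    (haper : (A + B).addStab = {0}) :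
    (∃ α β : G, #(insert α A + insert β B) + 1 = #(insert α A) + #(insert β B)) ∨
      ∃ (K : AddSubgroup G) (A₁ A₀ B₁ B₀ : Finset G), IsGrynkiewiczDecomp K A B A₁ A₀ B₁ B₀ := by
  refine conclusion_of_fourPairs_of_deepCore ?_ deep hA hB hAB haper
  intro G' _ A B h0A h0B hA3 _ _ _ _ _ _ _ _ _ _ H Hf γ₁ γ₂ x y x' y' hframe
  classical
  exact fourPairs_conclusion h0A h0B hA3 H Hf γ₁ γ₂ x y x' y' hframe

end Grynkiewicz2009

end Literature.Combinatorics.Additive
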